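import HarnessLib
import HarnessLib.Audit
import Summits.PneNP.PneNP.Theses.ChoicelessCapture

/-!
# Line `birth` — BC3 skeleton for the crux `ChoicelessCapturesP` (stmt-PneNP-18190)

Route `ChoicelessCapture` (route-PneNP-ChoicelessCapture), crux (rank 2)
`Summit.PneNP.PneNP.Theses.ChoicelessCapture.ChoicelessCapturesP` = CHOICELESS POLYNOMIAL TIME WITH
COUNTING CAPTURES P ON FINITE GRAPHS: every isomorphism-closed class of finite graphs whose language of
adjacency codes is polynomial-time is decided by some PTime-bounded BGS program with `Card`
(`∀ C, IsIsoClosed C → IsPTIMEClass C → CPTCardDefinable C`; the Blass–Gurevich–Shelah question,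
BGS 1999 §1 / 2002 §7, Grohe 2008 Problem 4, in the interface-free form of `IsCPTCard.capturesPTIME_iff`).

THE LINE = THE ROUTE'S OWN FORESEEN SPLIT OF CRUX 2 (route header, TWO-LAYER PLAN): CAPTURE VIA
CHOICELESS CANONISATION — "almost all capturing results define canonisation inside the logic"
(Lichter–Schweitzer, arXiv:2205.14003 §1; Grädel–Grohe 2015 §7; BGS 1999 Thm 2 / §7 for the ordered
simulation). Two named pieces, modus ponens as the seam (the FLT ⇐ Modularity ∧ (Modularity ⇒ FLT)
shape: one OPEN construction + one KNOWN but unformalised bridge):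

* `stub_choicelessCanonisation` — CHOICELESS CANONISATION OF ALL FINITE GRAPHS (the research half;
  OPEN; size: open problem): ONE PTime-bounded BGS program with counting which, run on any finite graph
  `G` on `n` atoms, halts within its bounds and OUTPUTS the atom-free HF-code (the set of Kuratowski
  pairs `⟨i, j⟩ = {{i}, {i, j}}` of von Neumann ordinals) of an ORDERED ISOMORPHIC COPY `H` of `G` on
  `{0, …, n−1}`. Because bounded BGS programs are isomorphism-invariant (tree theorem
  `CPTCardDefinable.isIsoClosed` / the equivariance of `CPTCardInvariance.lean`) and the output is
  atom-free, the copy `H` is automatically CANONICAL (`G ≅ G' ⇒ H(G) = H(G')`). Known rungs: CPT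
  canonises (hence captures P on) structures with bounded ABELIAN / dihedral colour classes
  (Lichter–Schweitzer, arXiv:2010.12182), the Cai–Fürer–Immerman graphs over ordered base graphs
  (Dawar–Richerby–Rossman 2008 Thm 22) and every class on which IFP+C canonises (graphs of bounded
  tree-width, planar graphs, excluded minors — Grohe 2017), since IFP+C ≤ CPT+Card (BGS 1999 Thm 6).
  HONEST COST (recorded for the lead / strategist): this stub is STRICTLY STRONGER than the crux — by
  the polynomial-time simulation of bounded programs (BGS 1999 Thm 1) it puts GRAPH CANONISATION in FP,
  hence GRAPH ISOMORPHISM in P (open; quasi-polynomial by Babai 2016) — whereas the crux alone is not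
  known to imply GI ∈ P. Conversely crux ∧ (an invariant canonical form computable in FP) gives the
  stub back (each bit of the code is an iso-invariant PTIME query, definable by capture, and CPT+Card
  assembles polynomially many bits). So the line bets on "CPT+Card = P and GI ∈ P at once"; the
  foreseen finer cut isolates the GI part: `IsoInCPT` (the isomorphism query on two-component graphs
  is CPT+Card-definable; DRR 2008 / LS 2021 rungs) → `CanonFromIso` (a definable isomorphism TEST
  yields definable CANONISATION for CPT+Card on all graphs — proved only with witnessed symmetric
  choice, CPT+WSC, Lichter–Schweitzer arXiv:2205.14003 Thm 1; for DeepWL ≡ CPT as a decision model only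
  a complete INVARIANT, Grohe–Schweitzer–Wiebking arXiv:2003.10935) → this stub. Not filed here (thin
  line, two layers; the encodings of graph PAIRS as single `FinGraph`s need their own vetting).
* `stub_captureFromCanonisation` — CAPTURE FROM CANONISATION = the route's SUPPORT ITEM
  `Summit.PneNP.PneNP.Theses.ChoicelessCapture.CaptureFromCanonisation` BY NAME (stmt-PneNP-18192,
  open, KNOWN mathematics, size XL): given the canonising program, every isomorphism-closed PTIME class
  `C` is CPT+Card-definable — run the canoniser, then simulate the class's polynomial-time Turing
  machine on the (ordered!) code of `H` inside a bounded BGS program (the Immerman–Vardi half: BGS 1999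
  Thm 2 "C̃PT captures P on ordered structures" / §7, composed with sequential composition of bounded
  programs); `G ∈ C ↔ H ∈ C` is exactly where `IsIsoClosed C` is consumed, and the machine being
  simulated is exactly where `IsPTIMEClass C` is consumed.
* `choicelessCapturesP_of_sigs` — the seam with explicit hypotheses (conclusion = the crux's body
  verbatim, so that `ChoicelessCapturesP_of` is the ONLY theorem of the file whose head is the crux
  name): modus ponens.
* `ChoicelessCapturesP_of : ChoicelessCapturesP` — THE skeleton theorem: the crux BY NAME from the two
  declared stubs (the only `sorry`s of the file).

Disproof used: no `Disproof.lean` exists for this crux (`ledger crux ls stmt-PneNP-18190`: no workfiles,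
no crux ideas, 2026-08-17T13:30Z). LANDED NEGATIVE LEMMAS honoured
(`Summits/PneNP/PneNP/Theorems/ChoicelessCapturesP/Negative/LoadBearing.lean`, refuter
rattack-stmt-PneNP-18190): `choicelessCapturesP_false_without_PTIME` (drop `IsPTIMEClass` ⇒ false, Cantor
diagonal over the countably many programs) and `choicelessCapturesP_false_without_isoClosed` (drop
`IsIsoClosed` ⇒ false, a labelled singleton class) — ANY proof must use both hypotheses, and this line
uses BOTH at `stub_captureFromCanonisation` (iso-closure to pass from `G` to its ordered copy `H`,
the PTIME machine as the object simulated); `stub_choicelessCanonisation` quantifies over no class at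
all, so neither negative lemma has an instance inside it; `countable_setOf_cptCardDefinable` is
consistent with the line (there are only countably many PTIME classes). Negatives index
(`ledger negatives --problem PneNP`): no refuted statement concerns definability / canonisation.
BC3 probes (seat folder `bc/probe_*.lean`, outputs in `Lines/birth.md` and the seat's NOTES.md):
`stub → ChoicelessCapturesP` and `stub → PneNP` by `first | exact? | simpa | aesop` (and the wider
battery `simpa [defs] | (unfold; simpa) | tauto | (intro h; exact?)`) FAIL for both stubs.
Planner planner-skel-stmt-PneNP-18190-0 (skeleton registrar, one-shot), 2026-08-17.
-/

set_option linter.dupNamespace false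
set_option linter.unusedVariables false

noncomputable section

namespace Summit.PneNP.PneNP.Cruxes.ChoicelessCapturesP.Birth

open scoped BigOperators Topology Manifold Classical MeasureTheory ProbabilityTheory Matrix InnerProductSpace ComplexConjugate ContinuousMap
open Filter Set Function TopologicalSpace MeasureTheory
open Literature.PNP

/-! ## The two registered stubs -/

/-- **Stub 1 (CHOICELESS CANONISATION of all finite graphs; OPEN PROBLEM — the research half of the
crux; strictly stronger than the crux by "graph canonisation ∈ FP ⊇ GI ∈ P", see the module
docstring).** There is ONE PTime-bounded BGS program with counting `P` such that for every finite graph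
`G` (on the atoms `Fin n`) the run of `P.prog` halts at some stage `l ≤ p(n)` with at most `q(n)` active
objects, and its `Output` is the atom-free HF-code — the set of Kuratowski pairs
`{{ord i}, {ord i, ord j}}` over the edges `(i, j)` — of some graph `H` on `Fin n` isomorphic to `G`
(an ORDERED COPY; canonical for free by isomorphism-invariance of bounded programs). This is the
antecedent of the route item `CaptureFromCanonisation`, verbatim.
[cite: arXivmath9705225, §7 and Thm 2] [cite: LichterSchweitzer2022, §1 and Thm 1]
[cite: DawarRicherbyRossman2008, Thm 22] [cite: Grohe2008, Problem 4] (bounded abelian colour classes: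
Lichter–Schweitzer 2021, arXiv:2010.12182) -/
theorem stub_choicelessCanonisation :
    ∃ P : Literature.ModelTheory.FiniteModelTheory.CPTCardProgram, ∀ G : Literature.ModelTheory.FiniteModelTheory.FinGraph, ∃ l : ℕ, l ≤ P.stepBound.eval G.1 ∧ P.prog.HaltsAt G.2 l ∧ (P.prog.activeSet G.2 l).encard ≤ ((P.activeBound.eval G.1 : ℕ) : ℕ∞) ∧ ∃ H : SimpleGraph (Fin G.1), Nonempty (G.2 ≃g H) ∧ (P.prog.stateAt G.2 l).output = Literature.ModelTheory.FiniteModelTheory.HF.ofFinset ((Finset.univ.filter fun p : Fin G.1 × Fin G.1 => H.Adj p.1 p.2).image fun p => Literature.ModelTheory.FiniteModelTheory.HF.pair (Literature.ModelTheory.FiniteModelTheory.HF.pair (Literature.ModelTheory.FiniteModelTheory.HF.ordinal p.1.val) (Literature.ModelTheory.FiniteModelTheory.HF.ordinal p.1.val)) (Literature.ModelTheory.FiniteModelTheory.HF.pair (Literature.ModelTheory.FiniteModelTheory.HF.ordinal p.1.val) (Literature.ModelTheory.FiniteModelTheory.HF.ordinal p.2.val))) := by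
  sorry

/-- **Stub 2 (CAPTURE FROM CANONISATION = route support item stmt-PneNP-18192
`CaptureFromCanonisation`, BY NAME; KNOWN mathematics, formalisation size XL — the Immerman–Vardi
half).** If one bounded program outputs on every finite graph the HF-code of an ordered isomorphic
copy, then every isomorphism-closed polynomial-time class of finite graphs is CPT+Card-definable:
compose the canoniser with a bounded BGS simulation of the class's polynomial-time machine on the
ordered code (BGS 1999 Thm 2 / §7: C̃PT, indeed already IFP, captures P on ordered inputs), using
`IsIsoClosed C` to transfer membership between `G` and its copy and `IsPTIMEClass C` for the machine.
[cite: arXivmath9705225, Thm 2 and §7] [cite: LichterSchweitzer2022, §1] [cite: Immerman1986]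
[cite: Immerman1999, Thm 4.10] -/
theorem stub_captureFromCanonisation :
    Summit.PneNP.PneNP.Theses.ChoicelessCapture.CaptureFromCanonisation := by
  sorry

/-! ## The composition (sorry-free) -/

/-- **The seam with explicit hypotheses** (BC3 shape `canonisation → (canonisation → capture) →
crux`; the conclusion is the crux's body verbatim): modus ponens — the route item
`CaptureFromCanonisation` unfolds to `(canonisation) → ChoicelessCapturesP`. [folklore] -/
theorem choicelessCapturesP_of_sigs
    (hcan : ∃ P : Literature.ModelTheory.FiniteModelTheory.CPTCardProgram, ∀ G : Literature.ModelTheory.FiniteModelTheory.FinGraph, ∃ l : ℕ, l ≤ P.stepBound.eval G.1 ∧ P.prog.HaltsAt G.2 l ∧ (P.prog.activeSet G.2 l).encard ≤ ((P.activeBound.eval G.1 : ℕ) : ℕ∞) ∧ ∃ H : SimpleGraph (Fin G.1), Nonempty (G.2 ≃g H) ∧ (P.prog.stateAt G.2 l).output = Literature.ModelTheory.FiniteModelTheory.HF.ofFinset ((Finset.univ.filter fun p : Fin G.1 × Fin G.1 => H.Adj p.1 p.2).image fun p => Literature.ModelTheory.FiniteModelTheory.HF.pair (Literature.ModelTheory.FiniteModelTheory.HF.pair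 (Literature.ModelTheory.FiniteModelTheory.HF.ordinal p.1.val) (Literature.ModelTheory.FiniteModelTheory.HF.ordinal p.1.val)) (Literature.ModelTheory.FiniteModelTheory.HF.pair (Literature.ModelTheory.FiniteModelTheory.HF.ordinal p.1.val) (Literature.ModelTheory.FiniteModelTheory.HF.ordinal p.2.val))))
    (hcap : Summit.PneNP.PneNP.Theses.ChoicelessCapture.CaptureFromCanonisation) :
    ∀ C : Set Literature.ModelTheory.FiniteModelTheory.FinGraph, Literature.ModelTheory.FiniteModelTheory.IsIsoClosed C → Literature.ModelTheory.FiniteModelTheory.IsPTIMEClass C → Literature.ModelTheory.FiniteModelTheory.CPTCardDefinable C :=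
  hcap hcan

/-- **THE SKELETON THEOREM.** The crux `Summit.PneNP.PneNP.Theses.ChoicelessCapture.ChoicelessCapturesP`,
concluded BY NAME from the two DECLARED stubs `stub_choicelessCanonisation` and
`stub_captureFromCanonisation` (the only `sorry`s of the file) through the sorry-free seam
`choicelessCapturesP_of_sigs`. [folklore] -/
theorem ChoicelessCapturesP_of : Summit.PneNP.PneNP.Theses.ChoicelessCapture.ChoicelessCapturesP :=
  choicelessCapturesP_of_sigs stub_choicelessCanonisation stub_captureFromCanonisation

end Summit.PneNP.PneNP.Cruxes.ChoicelessCapturesP.Birth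

end
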